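import Literature.IUT.HodgeArakelov.LabelClassesOfCuspsLevelCount
import Literature.IUT.HodgeArakelov.LabelClassesOfCuspsCardGenuineTempered
import Literature.IUT.HodgeArakelov.PlusMinusTowerCoverModelAPI
import Literature.IUT.HodgeArakelov.PlusMinusTowerPiVIndex
import Literature.IUT.HodgeArakelov.LabCuspStructureNonVacuity
import HarnessLib

/-!
# [IUTchII] Def 2.3 (iii) at the GENUINE tower: `|LabCusp^±(Π_v)| = l` — the `Π_v`-LEVEL count, hence `LabCuspStructure` EXISTS, from TEMPERED
# facts only ([SemiAnbd] Thm 6.5 (ii) BY NAME + Rmk 2.3.1)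

S. Mochizuki, *Inter-universal Teichmüller theory II*, kurims manuscript (Dec. 2020), §2 Def 2.3 (ii) p. 68 («the cuspidal inertia groups of `Π_⊆`
may be obtained as the intersections with `Π_⊆` of those cuspidal inertia groups of `Π_⊇` …»), Def 2.3 (iii) p. 68 («`LabCusp^±(Π_v)` … admits a
natural action by `𝔽_l^×`, as well as a zero element `η^0_v` and a `±`-canonical element `η^±_v`» — a set of `l` elements), Rmk 2.3.1 p. 69
(«`I ∩ Π_⊆ = I^l`») [claim: Mochizuki2012, status: disputed] (IUTchII §2 Def 2.3 (iii), kurims p.68) (D-0012 claim key; record-only).  Inputs in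
print: [SemiAnbd] Thm 6.5 (ii) p. 71 («`D_x` is commensurably terminal … `D_x = C_{Π^temp_{X_K}}(H)` for any open subgroup `H ⊆ I_x`»)
[cite: MochizukiSemiAnbd2006, Thm 6.5(ii) p.71]; [EtTh] Def 2.5 (i) p. 39 (`X̲ → X`) [cite: MochizukiEtTh2009, Def 2.5 (i) p.39].

abc-iut cell, seat abc-iut-w5-d132 (gen 6), row «DEF23iii-CARD-V» part 2 (instance of `LabelClassesOfCuspsLevelCount`).  PROOF-ONLY (no `def`, no
instance, no new named fact).  At abc-iut-L6-t19's genuine tower `ofCoverModel` / `ofPiCHat` (`Π_v = ι(inclX Π^tp_{X̲̲})`, `Π^±_v = ι(inclX Π^tp_{X̲})`,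
`Π^cor_v = ι(Π^tp_C)`; `PlusMinusTowerCoverModelAPI`), for ANY cuspidal datum `Cu` whose cusps of `Π^±_v` are the `ι(inclX Π^tp_X)`-conjugates of
`J₀ = ι(inclX I_{x₀})` (`hCuPM` — the shape of the tempered (A)-family; companion `LabelClassesOfCuspsRangeXHomogeneous` derives it from the p430433 characterisation)
and whose cusps of `Π_v` are the INTERSECTIONS with `Π_v` (`hlev`, abc-iut-L6-t7's clause «`I = I₀ ⊓ Q`» of p434636), satisfying Rmk 2.3.1
«`I ∩ Π_v = I^l`» (`hR231 : Rmk231_powers Cu Π_v Π^±_v`, abc-iut-L6-t19's theorem p444107/p445460 at the agreement datum):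

* `isCuspidalInertia_piV_iff_rangeX` — HOMOGENEITY AT LEVEL `Π_v`: the cusps of `Π_v` are the `ι(inclX Π^tp_X)`-conjugates of
  `J₀' := ι(inclX(I_{x₀} ∩ Π^tp_{X̲̲}))` (`= J₀ ∩ Π_v = J₀^l`);
* `normalizer_map_inertiaInfHuu_inf_piPM_eq` — `N_{Π^±_v}(J₀') = ι(inclX D_{x₀})` ⟸ [SemiAnbd] Thm 6.5 (ii) `DecompEqCommensuratorOfOpenInertia`
  (FACT-LIST F-1658 family, BY NAME) applied to the OPEN subgroup `I_{x₀} ∩ Π^tp_{X̲̲} ⊆ I_{x₀}`; `D_{x₀}` normalises it (`D_{x₀} ≤ Π^tp_{X̲}` ⊵ `Π^tp_{X̲̲}`, hN);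
* `normalizer_map_decomp_le_piPM` — `N_{Π^tp_X}(D_{x₀}) = D_{x₀} ≤ Π^tp_{X̲}` ⟸ `DecompCommensurablyTerminal` (F-1658, BY NAME) + (P3);
* **`card_labCuspPM_piV_ofCoverModel_eq_l`** — `Nat.card (LabCuspPM Cu W.piV W.piPM) = l` = `[Π^tp_X : Π^tp_{X̲}]` (abc-iut-L2's `index_GtpXu`), by
  `card_labCuspPM_level_eq_index` with `R = ι(inclX Π^tp_X)` (the stabiliser is `Π^±_v` itself — NO inversion and NO profinite separation at this level);
* **`nonempty_labCuspStructure_ofCoverModel`** / **`…_ofPiCHat`** — Def 2.3 (iii)'s interface `LabCuspStructure Cu` is INHABITED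
  (abc-iut-w5-d028's `LabCuspStructure.nonempty_iff_nonempty_equiv`, p419304): the first conjunct of abc-iut-w5-d243's `def23_structuresConj_iff_card`.

HONEST LABEL: theorems about the kernel's genuine tower over abc-iut-L2's [EtTh] interface data modulo named inputs: [SemiAnbd] Thm 6.5 (ii)
(F-1658 `DecompCommensurablyTerminal` + its second clause `DecompEqCommensuratorOfOpenInertia`) BY NAME, the parameter bundle `op`, `hN`, and the
datum's level clauses `hCuPM` / `hlev` / `hR231` (printed Def 2.3 (ii) / Rmk 2.3.1 shapes; theorems of abc-iut-L6-t19 at the agreement datum);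
whether ONE datum of record carries all levels is a MERGE-MAP question, not settled here.  Nothing of the series is asserted; no side taken on
[IUTchIII] Cor 3.12; typed ≠ proved; witnessed ≠ endorsed.
-/

noncomputable section

namespace Literature.IUT.HodgeArakelov

open Literature.AnabelianGeometry Literature.AnabelianGeometry.EtaleTheta Literature.AnabelianGeometry.SemiGraphs
open scoped Pointwise

/-! ## 0. Generic bookkeeping -/

section Generic

variable {A B : Type*} [Group A] [Group B]

/-- Pushing a conjugate forward: `f(a H a⁻¹) = f(a) f(H) f(a)⁻¹`. [folklore] -/
private theorem map_conj_smul₃ (f : A →* B) (a : A) (H : Subgroup A) :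
    (MulAut.conj a • H).map f = MulAut.conj (f a) • H.map f := by
  rw [conj_smul_eq_map_conj, conj_smul_eq_map_conj, Subgroup.map_map, Subgroup.map_map]
  congr 1
  ext x
  simp [MulAut.conj_apply]

/-- Conjugation commutes with «closure of the `n`-th powers»: `a · ⟨K^n⟩ · a⁻¹ = ⟨(a K a⁻¹)^n⟩`. [folklore] -/
private theorem conj_smul_closure_pow (a : A) (K : Subgroup A) (n : ℕ) :
    MulAut.conj a • Subgroup.closure ((fun x : A => x ^ n) '' (K : Set A)) =
      Subgroup.closure ((fun x : A => x ^ n) '' ((MulAut.conj a • K : Subgroup A) : Set A)) := by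
  rw [conj_smul_eq_map_conj, MonoidHom.map_closure, Subgroup.coe_pointwise_smul, ← Set.image_smul, Set.image_image,
    Set.image_image]
  congr 1
  ext x
  simp [MulAut.conj_apply, conj_pow]

/-- If `H ≤ K` is normal in `K`, every `d ∈ K` normalises `H`. [folklore] -/
private theorem conj_smul_eq_self_of_normal_subgroupOf {H K : Subgroup A} (hHK : H ≤ K) [hn : (H.subgroupOf K).Normal]
    {d : A} (hd : d ∈ K) : MulAut.conj d • H = H := by
  have key : ∀ {d : A}, d ∈ K → ∀ h ∈ H, d * h * d⁻¹ ∈ H := by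
    intro d hd h hh
    have := hn.conj_mem ⟨h, hHK hh⟩ (Subgroup.mem_subgroupOf.mpr hh) ⟨d, hd⟩
    exact Subgroup.mem_subgroupOf.mp this
  apply le_antisymm
  · rintro x ⟨h, hh, rfl⟩
    exact key hd h hh
  · intro h hh
    refine ⟨d⁻¹ * h * d, ?_, by simp [MulAut.conj_apply, mul_assoc]⟩
    have := key (K.inv_mem hd) h hh
    rwa [inv_inv] at this

end Generic

namespace PlusMinusTower

variable {p : ℕ} [Fact p.Prime] {M : MuTwoSetting p} (e : M.CLevelData)
  {E : M.toThetaSetting.EtaleThetaData} {l : ℕ} (C : E.DoubleUnderline l) {N : ℕ+}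
  (μ : M.toThetaSetting.CyclotomeMod l N) (hC : M.toThetaSetting.Compat) (hS : M.toThetaSetting.Sec2Hyps)
  (hl : l.Prime) (hp2 : p ≠ 2) (hpl : p ≠ l) (hζ : ∃ ζ : M.toThetaSetting.K, IsPrimitiveRoot ζ (4 * l))
  {η : (C.thetaEnvData μ hC hS).PiYdd → MuN p N} (hη : η ∈ (C.thetaEnvData μ hC hS).thetaCocycles)
  {Q : Type} [Group Q] [TopologicalSpace Q] [IsTopologicalGroup Q]
  (ι : M.GtpC →ₜ* Q) (hι : IsProfiniteCompletion ι) (hinj : Function.Injective ι)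
  (Φ : Q →* GQp p) (hΦ : ∀ g : M.GtpC, Φ (ι g) = e.augC g) (hΦK : Φ.range = M.GK)
  (hZ : Thm16Sub.KerToZIsCompactlyGenerated M.toThetaSetting) (hN : (C.Huu.subgroupOf (M.GtpXu l)).Normal)
  {P : TopGroup.{0}} (T : TemperedCoverings (BadPlaceSetting.ofUnderline C μ hC hS hl hp2 hpl hζ hη) P) {x₀ : M.Pt}

/-! ## 1. Tempered objects in `Q`: `J₀' = ι(inclX(I_{x₀} ∩ Π^tp_{X̲̲}))`, `D' = ι(inclX D_{x₀})`, `Π_X' = ι(inclX Π^tp_X)` -/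

section Objects

include hinj in
omit [IsTopologicalGroup Q] in
/-- `ι ∘ inclX` is injective. [cite: MochizukiEtTh2009, Def 1.7 p.27] -/
theorem injective_ι_comp_inclX : Function.Injective (ι.toMonoidHom.comp M.inclX) :=
  hinj.comp M.injective_inclX

omit [IsTopologicalGroup Q] in
/-- `ι(inclX Π^tp_X)` normalises `Π^±_v = ι(inclX Π^tp_{X̲})` (`Π^tp_{X̲} ⊴ Π^tp_X`). [cite: MochizukiEtTh2009, Def 2.5 (i) p.39] -/
theorem conj_smul_map_GtpXu_of_mem_rangeX {r : Q} (hr : r ∈ (M.inclX.range.map ι.toMonoidHom : Subgroup Q)) :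
    MulAut.conj r • (((M.GtpXu l).map M.inclX).map ι.toMonoidHom : Subgroup Q) = ((M.GtpXu l).map M.inclX).map ι.toMonoidHom := by
  obtain ⟨w, ⟨y, rfl⟩, rfl⟩ := hr
  rw [← map_conj_smul₃, ← map_conj_smul₃, Subgroup.Normal.conj_smul_eq_self]

include hinj C hN in
omit [IsTopologicalGroup Q] in
/-- **`N_{Π^±_v}(J₀') = ι(inclX D_{x₀})`** for `J₀' = ι(inclX(I_{x₀} ∩ Π^tp_{X̲̲}))`: `⊆` by [SemiAnbd] Thm 6.5 (ii) second clause
(`DecompEqCommensuratorOfOpenInertia`, applied to the OPEN subgroup `I_{x₀} ∩ Π^tp_{X̲̲} ⊆ I_{x₀}`; normaliser ≤ commensurator); `⊇` because `D_{x₀}`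
normalises `I_{x₀}` and — lying in `Π^tp_{X̲}` by (P3) — `Π^tp_{X̲̲}` (hN). [cite: MochizukiSemiAnbd2006, Thm 6.5(ii) p.71] -/
theorem normalizer_map_inertiaInfHuu_inf_piPM_eq (op : M.toThetaSetting.OncePuncturedData) (hx₀ : M.IsCusp x₀)
    (h65ii : M.toTemperedCurve.DecompEqCommensuratorOfOpenInertia) :
    Subgroup.normalizer ((((M.toTemperedCurve.inertia x₀ ⊓ C.Huu).map M.inclX).map ι.toMonoidHom : Subgroup Q) : Set Q) ⊓
        ((M.GtpXu l).map M.inclX).map ι.toMonoidHom =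
      ((M.decomp x₀).map M.inclX).map ι.toMonoidHom := by
  have hψ := injective_ι_comp_inclX ι hinj
  haveI : M.toTemperedCurve.DeltaTemp.Normal := by unfold TemperedCurve.DeltaTemp; infer_instance
  have hDU : M.decomp x₀ ≤ M.GtpXu l := decomp_le_GtpXu op hx₀
  apply le_antisymm
  · intro z hz
    obtain ⟨hzN, hzU⟩ := Subgroup.mem_inf.mp hz
    obtain ⟨w, ⟨y, hy, rfl⟩, rfl⟩ := hzU
    -- `y ∈ Π^tp_{X̲}` normalises `I_{x₀} ∩ Π^tp_{X̲̲}`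
    rw [mem_normalizer_iff_conj_smul_eq, Subgroup.map_map] at hzN
    change MulAut.conj ((ι.toMonoidHom.comp M.inclX) y) • _ = _ at hzN
    rw [← map_conj_smul₃] at hzN
    have hy' : MulAut.conj y • (M.toTemperedCurve.inertia x₀ ⊓ C.Huu) = M.toTemperedCurve.inertia x₀ ⊓ C.Huu :=
      Subgroup.map_injective hψ hzN
    have hopen : IsOpen (((M.toTemperedCurve.inertia x₀ ⊓ C.Huu).subgroupOf (M.toTemperedCurve.inertia x₀) :
        Subgroup (M.toTemperedCurve.inertia x₀)) : Set (M.toTemperedCurve.inertia x₀)) := by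
      have hset : (((M.toTemperedCurve.inertia x₀ ⊓ C.Huu).subgroupOf (M.toTemperedCurve.inertia x₀) :
          Subgroup (M.toTemperedCurve.inertia x₀)) : Set (M.toTemperedCurve.inertia x₀)) = Subtype.val ⁻¹' (C.Huu : Set M.PiTemp) := by
        ext ⟨z, hz⟩
        simp [Subgroup.mem_subgroupOf]
      rw [hset]
      exact C.isOpen_Huu.preimage continuous_subtype_val
    have hcomm := h65ii x₀ hx₀ _ inf_le_left hopen
    have hyD : y ∈ M.decomp x₀ := by
      rw [← hcomm]
      exact Anabelioids.normalizer_le_commensurator _ (mem_normalizer_iff_conj_smul_eq.mpr hy')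
    rw [Subgroup.map_map]
    exact ⟨y, hyD, rfl⟩
  · rintro z ⟨w, ⟨d, hd, rfl⟩, rfl⟩
    refine Subgroup.mem_inf.mpr ⟨?_, ⟨M.inclX d, ⟨d, hDU hd, rfl⟩, rfl⟩⟩
    rw [mem_normalizer_iff_conj_smul_eq, Subgroup.map_map]
    change MulAut.conj ((ι.toMonoidHom.comp M.inclX) d) • _ = _
    rw [← map_conj_smul₃, Subgroup.smul_inf, TemperedCurve.inertia, Subgroup.smul_inf, Subgroup.conj_smul_eq_self_of_mem hd,
      Subgroup.Normal.conj_smul_eq_self, conj_smul_eq_self_of_normal_subgroupOf C.Huu_le_GtpXu (hDU hd)]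

include hinj in
omit [IsTopologicalGroup Q] in
/-- **`N_{Π^tp_X}(D_{x₀}) ≤ D_{x₀} ≤ Π^tp_{X̲}`**, pushed into `Q`: an element of `ι(inclX Π^tp_X)` normalising `ι(inclX D_{x₀})` lies in `Π^±_v = ι(inclX Π^tp_{X̲})`
— [SemiAnbd] Thm 6.5 (ii) first clause `DecompCommensurablyTerminal` (F-1658, BY NAME) + (P3). [cite: MochizukiSemiAnbd2006, Thm 6.5(ii) p.71] -/
theorem normalizer_map_decomp_le_piPM (op : M.toThetaSetting.OncePuncturedData) (hx₀ : M.IsCusp x₀)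
    (h65 : M.toTemperedCurve.DecompCommensurablyTerminal) {r : Q} (hr : r ∈ (M.inclX.range.map ι.toMonoidHom : Subgroup Q))
    (hrD : MulAut.conj r • (((M.decomp x₀).map M.inclX).map ι.toMonoidHom : Subgroup Q) = ((M.decomp x₀).map M.inclX).map ι.toMonoidHom) :
    r ∈ (((M.GtpXu l).map M.inclX).map ι.toMonoidHom : Subgroup Q) := by
  obtain ⟨w, ⟨y, rfl⟩, rfl⟩ := hr
  rw [← map_conj_smul₃, ← map_conj_smul₃, Subgroup.map_map, Subgroup.map_map] at hrD
  have hy : MulAut.conj y • M.decomp x₀ = M.decomp x₀ := Subgroup.map_injective (injective_ι_comp_inclX ι hinj) hrD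
  have hyD : y ∈ M.decomp x₀ := by
    rw [← h65 x₀]
    exact Anabelioids.normalizer_le_commensurator _ (mem_normalizer_iff_conj_smul_eq.mpr hy)
  exact ⟨M.inclX y, ⟨y, decomp_le_GtpXu op hx₀ hyD, rfl⟩, rfl⟩

include hinj in
omit [IsTopologicalGroup Q] in
/-- `[ι(inclX Π^tp_X) : ι(inclX Π^tp_{X̲})] = l` (`[Π^tp_X : Π^tp_{X̲}] = l`, abc-iut-L2 `index_GtpXu`; images under the injective `ι ∘ inclX`).
[cite: MochizukiEtTh2009, Def 2.5 (i) p.39] -/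
theorem index_map_GtpXu_subgroupOf_rangeX :
    ((((M.GtpXu l).map M.inclX).map ι.toMonoidHom : Subgroup Q).subgroupOf (M.inclX.range.map ι.toMonoidHom)).index = l := by
  change (((M.GtpXu l).map M.inclX).map ι.toMonoidHom : Subgroup Q).relIndex (M.inclX.range.map ι.toMonoidHom) = l
  rw [MonoidHom.range_eq_map, Subgroup.map_map, Subgroup.map_map,
    Subgroup.relIndex_map_map_of_injective _ _ (injective_ι_comp_inclX ι hinj), Subgroup.relIndex_top_right,
    M.toThetaSetting.index_GtpXu]

end Objects

/-! ## 2. Homogeneity at level `Π_v` and the count -/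

section Tower

/-- **HOMOGENEITY AT LEVEL `Π_v`.**  If the cusps of `Π^±_v` are the `ι(inclX Π^tp_X)`-conjugates of `J₀` (`hCuPM`), the cusps of `Π_v` are the
intersections with `Π_v` (`hlev`) and Rmk 2.3.1 «`I ∩ Π_v = I^l`» holds (`hR231`), then the cusps of `Π_v` are EXACTLY the
`ι(inclX Π^tp_X)`-conjugates of `J₀ ∩ Π_v` (conjugation commutes with «`l`-th powers»).
([IUTchII] Def 2.3 (ii)/(iii), Rmk 2.3.1, kurims pp.68–69) [claim: Mochizuki2012, status: disputed] -/
theorem isCuspidalInertia_piV_iff_rangeX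
    (Cu : CuspidalInertiaData (ofCoverModel e C μ hC hS hl hp2 hpl hζ hη ι hι hinj Φ hΦ hΦK hZ hN T))
    (hCuPM : ∀ I : Subgroup (ofCoverModel e C μ hC hS hl hp2 hpl hζ hη ι hι hinj Φ hΦ hΦK hZ hN T).Corhat,
      Cu.IsCuspidalInertia (ofCoverModel e C μ hC hS hl hp2 hpl hζ hη ι hι hinj Φ hΦ hΦK hZ hN T).piPM I ↔
        ∃ r ∈ (M.inclX.range.map ι.toMonoidHom : Subgroup (ofCoverModel e C μ hC hS hl hp2 hpl hζ hη ι hι hinj Φ hΦ hΦK hZ hN T).Corhat),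
          I = MulAut.conj r • (((M.toTemperedCurve.inertia x₀).map M.inclX).map ι.toMonoidHom :
            Subgroup (ofCoverModel e C μ hC hS hl hp2 hpl hζ hη ι hι hinj Φ hΦ hΦK hZ hN T).Corhat))
    (hlev : ∀ J : Subgroup (ofCoverModel e C μ hC hS hl hp2 hpl hζ hη ι hι hinj Φ hΦ hΦK hZ hN T).Corhat,
      Cu.IsCuspidalInertia (ofCoverModel e C μ hC hS hl hp2 hpl hζ hη ι hι hinj Φ hΦ hΦK hZ hN T).piV J ↔
        J ≤ (ofCoverModel e C μ hC hS hl hp2 hpl hζ hη ι hι hinj Φ hΦ hΦK hZ hN T).piV ∧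
          ∃ I₀, Cu.IsCuspidalInertia (ofCoverModel e C μ hC hS hl hp2 hpl hζ hη ι hι hinj Φ hΦ hΦK hZ hN T).piPM I₀ ∧
            J = I₀ ⊓ (ofCoverModel e C μ hC hS hl hp2 hpl hζ hη ι hι hinj Φ hΦ hΦK hZ hN T).piV)
    (hR231 : Rmk231_powers Cu (ofCoverModel e C μ hC hS hl hp2 hpl hζ hη ι hι hinj Φ hΦ hΦK hZ hN T).piV
      (ofCoverModel e C μ hC hS hl hp2 hpl hζ hη ι hι hinj Φ hΦ hΦK hZ hN T).piPM)
    (J : Subgroup (ofCoverModel e C μ hC hS hl hp2 hpl hζ hη ι hι hinj Φ hΦ hΦK hZ hN T).Corhat) :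
    Cu.IsCuspidalInertia (ofCoverModel e C μ hC hS hl hp2 hpl hζ hη ι hι hinj Φ hΦ hΦK hZ hN T).piV J ↔
      ∃ r ∈ (M.inclX.range.map ι.toMonoidHom : Subgroup (ofCoverModel e C μ hC hS hl hp2 hpl hζ hη ι hι hinj Φ hΦ hΦK hZ hN T).Corhat),
        J = MulAut.conj r • ((((M.toTemperedCurve.inertia x₀).map M.inclX).map ι.toMonoidHom :
            Subgroup (ofCoverModel e C μ hC hS hl hp2 hpl hζ hη ι hι hinj Φ hΦ hΦK hZ hN T).Corhat) ⊓
          (ofCoverModel e C μ hC hS hl hp2 hpl hζ hη ι hι hinj Φ hΦ hΦK hZ hN T).piV) := by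
  -- `Π_v < Π^±_v` (index `l ≥ 2`)
  have hlt : (ofCoverModel e C μ hC hS hl hp2 hpl hζ hη ι hι hinj Φ hΦ hΦK hZ hN T).piV <
      (ofCoverModel e C μ hC hS hl hp2 hpl hζ hη ι hι hinj Φ hΦ hΦK hZ hN T).piPM := by
    refine lt_of_le_of_ne (ofCoverModel e C μ hC hS hl hp2 hpl hζ hη ι hι hinj Φ hΦ hΦK hZ hN T).piV_le_piPM fun h => ?_
    have hidx := (ofCoverModel e C μ hC hS hl hp2 hpl hζ hη ι hι hinj Φ hΦ hΦK hZ hN T).index_piV_subgroupOf_piPM_ofUnderline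
      C μ hC hS hl hp2 hpl hζ hη
    rw [h, Subgroup.subgroupOf_self, Subgroup.index_top] at hidx
    exact hl.one_lt.ne hidx
  have hpow := hR231 hlt
  have hJ₀c : Cu.IsCuspidalInertia (ofCoverModel e C μ hC hS hl hp2 hpl hζ hη ι hι hinj Φ hΦ hΦK hZ hN T).piPM
      (((M.toTemperedCurve.inertia x₀).map M.inclX).map ι.toMonoidHom :
        Subgroup (ofCoverModel e C μ hC hS hl hp2 hpl hζ hη ι hι hinj Φ hΦ hΦK hZ hN T).Corhat) :=
    (hCuPM _).mpr ⟨1, Subgroup.one_mem _, by rw [map_one, one_smul]⟩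
  constructor
  · intro hJ
    obtain ⟨-, I₀, hI₀, rfl⟩ := (hlev J).mp hJ
    obtain ⟨r, hr, rfl⟩ := (hCuPM I₀).mp hI₀
    refine ⟨r, hr, ?_⟩
    rw [hpow _ hI₀, hpow _ hJ₀c, conj_smul_closure_pow]
  · rintro ⟨r, hr, rfl⟩
    have hI₀ : Cu.IsCuspidalInertia (ofCoverModel e C μ hC hS hl hp2 hpl hζ hη ι hι hinj Φ hΦ hΦK hZ hN T).piPM
        (MulAut.conj r • (((M.toTemperedCurve.inertia x₀).map M.inclX).map ι.toMonoidHom :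
          Subgroup (ofCoverModel e C μ hC hS hl hp2 hpl hζ hη ι hι hinj Φ hΦ hΦK hZ hN T).Corhat)) :=
      (hCuPM _).mpr ⟨r, hr, rfl⟩
    refine (hlev _).mpr ⟨?_, _, hI₀, ?_⟩
    · rw [hpow _ hJ₀c, conj_smul_closure_pow, ← hpow _ hI₀]
      exact inf_le_right
    · rw [hpow _ hJ₀c, conj_smul_closure_pow, ← hpow _ hI₀]

/-- **`|LabCusp^±(Π_v)| = l` AT THE GENUINE TOWER `ofCoverModel`** — the `Π_v`-LEVEL count — for every cuspidal datum with `ι(inclX Π^tp_X)`-homogeneous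
`Π^±_v`-cusps (`hCuPM`), levels by intersection (`hlev`) and Rmk 2.3.1 (`hR231`): the label classes are `ι(inclX Π^tp_X) / Π^±_v`, of cardinality
`[Π^tp_X : Π^tp_{X̲}] = l` — the stabiliser of `⟦J₀ ∩ Π_v⟧` being `N(N_{Π^±_v}(J₀ ∩ Π_v)) · Π^±_v = N(ι inclX D_{x₀}) · Π^±_v = Π^±_v` by [SemiAnbd] Thm 6.5
(ii) (`h65`, `h65ii`, F-1658 family BY NAME).  NO profinite input. ([IUTchII] Def 2.3 (iii), kurims p.68) [claim: Mochizuki2012, status: disputed] -/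
theorem card_labCuspPM_piV_ofCoverModel_eq_l (op : M.toThetaSetting.OncePuncturedData) (hx₀ : M.IsCusp x₀)
    (h65 : M.toTemperedCurve.DecompCommensurablyTerminal) (h65ii : M.toTemperedCurve.DecompEqCommensuratorOfOpenInertia)
    (Cu : CuspidalInertiaData (ofCoverModel e C μ hC hS hl hp2 hpl hζ hη ι hι hinj Φ hΦ hΦK hZ hN T))
    (hCuPM : ∀ I : Subgroup (ofCoverModel e C μ hC hS hl hp2 hpl hζ hη ι hι hinj Φ hΦ hΦK hZ hN T).Corhat,
      Cu.IsCuspidalInertia (ofCoverModel e C μ hC hS hl hp2 hpl hζ hη ι hι hinj Φ hΦ hΦK hZ hN T).piPM I ↔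
        ∃ r ∈ (M.inclX.range.map ι.toMonoidHom : Subgroup (ofCoverModel e C μ hC hS hl hp2 hpl hζ hη ι hι hinj Φ hΦ hΦK hZ hN T).Corhat),
          I = MulAut.conj r • (((M.toTemperedCurve.inertia x₀).map M.inclX).map ι.toMonoidHom :
            Subgroup (ofCoverModel e C μ hC hS hl hp2 hpl hζ hη ι hι hinj Φ hΦ hΦK hZ hN T).Corhat))
    (hlev : ∀ J : Subgroup (ofCoverModel e C μ hC hS hl hp2 hpl hζ hη ι hι hinj Φ hΦ hΦK hZ hN T).Corhat,
      Cu.IsCuspidalInertia (ofCoverModel e C μ hC hS hl hp2 hpl hζ hη ι hι hinj Φ hΦ hΦK hZ hN T).piV J ↔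
        J ≤ (ofCoverModel e C μ hC hS hl hp2 hpl hζ hη ι hι hinj Φ hΦ hΦK hZ hN T).piV ∧
          ∃ I₀, Cu.IsCuspidalInertia (ofCoverModel e C μ hC hS hl hp2 hpl hζ hη ι hι hinj Φ hΦ hΦK hZ hN T).piPM I₀ ∧
            J = I₀ ⊓ (ofCoverModel e C μ hC hS hl hp2 hpl hζ hη ι hι hinj Φ hΦ hΦK hZ hN T).piV)
    (hR231 : Rmk231_powers Cu (ofCoverModel e C μ hC hS hl hp2 hpl hζ hη ι hι hinj Φ hΦ hΦK hZ hN T).piV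
      (ofCoverModel e C μ hC hS hl hp2 hpl hζ hη ι hι hinj Φ hΦ hΦK hZ hN T).piPM) :
    Nat.card (LabCuspPM Cu (ofCoverModel e C μ hC hS hl hp2 hpl hζ hη ι hι hinj Φ hΦ hΦK hZ hN T).piV
      (ofCoverModel e C μ hC hS hl hp2 hpl hζ hη ι hι hinj Φ hΦ hΦK hZ hN T).piPM) = l := by
  let ιW : M.GtpC →* (ofCoverModel e C μ hC hS hl hp2 hpl hζ hη ι hι hinj Φ hΦ hΦK hZ hN T).Corhat := ι.toMonoidHom
  have hψ := injective_ι_comp_inclX ι hinj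
  have hPM : (ofCoverModel e C μ hC hS hl hp2 hpl hζ hη ι hι hinj Φ hΦ hΦK hZ hN T).piPM = ((M.GtpXu l).map M.inclX).map ιW :=
    piPM_ofCoverModel e C μ hC hS hl hp2 hpl hζ hη ι hι hinj Φ hΦ hΦK hZ hN T
  have hV : (ofCoverModel e C μ hC hS hl hp2 hpl hζ hη ι hι hinj Φ hΦ hΦK hZ hN T).piV = (C.Huu.map M.inclX).map ιW :=
    piV_ofCoverModel e C μ hC hS hl hp2 hpl hζ hη ι hι hinj Φ hΦ hΦK hZ hN T
  -- `J₀ ∩ Π_v = ι(inclX(I_{x₀} ∩ Π^tp_{X̲̲}))`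
  have hJ₀' : (((M.toTemperedCurve.inertia x₀).map M.inclX).map ι.toMonoidHom :
        Subgroup (ofCoverModel e C μ hC hS hl hp2 hpl hζ hη ι hι hinj Φ hΦ hΦK hZ hN T).Corhat) ⊓
          (ofCoverModel e C μ hC hS hl hp2 hpl hζ hη ι hι hinj Φ hΦ hΦK hZ hN T).piV =
      ((M.toTemperedCurve.inertia x₀ ⊓ C.Huu).map M.inclX).map ιW := by
    rw [hV, Subgroup.map_map, Subgroup.map_map, Subgroup.map_map]
    exact (Subgroup.map_inf _ _ _ hψ).symm
  have hQR : (ofCoverModel e C μ hC hS hl hp2 hpl hζ hη ι hι hinj Φ hΦ hΦK hZ hN T).piPM ≤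
      (M.inclX.range.map ιW : Subgroup (ofCoverModel e C μ hC hS hl hp2 hpl hζ hη ι hι hinj Φ hΦ hΦK hZ hN T).Corhat) := by
    rw [hPM]; exact Subgroup.map_mono (Subgroup.map_le_range _ _)
  have hRQ : ∀ r ∈ (M.inclX.range.map ιW : Subgroup (ofCoverModel e C μ hC hS hl hp2 hpl hζ hη ι hι hinj Φ hΦ hΦK hZ hN T).Corhat),
      MulAut.conj r • (ofCoverModel e C μ hC hS hl hp2 hpl hζ hη ι hι hinj Φ hΦ hΦK hZ hN T).piPM =
        (ofCoverModel e C μ hC hS hl hp2 hpl hζ hη ι hι hinj Φ hΦ hΦK hZ hN T).piPM := by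
    intro r hr
    rw [hPM]
    exact conj_smul_map_GtpXu_of_mem_rangeX ι hr
  have hhom : ∀ J, Cu.IsCuspidalInertia (ofCoverModel e C μ hC hS hl hp2 hpl hζ hη ι hι hinj Φ hΦ hΦK hZ hN T).piV J ↔
      ∃ r ∈ (M.inclX.range.map ιW : Subgroup (ofCoverModel e C μ hC hS hl hp2 hpl hζ hη ι hι hinj Φ hΦ hΦK hZ hN T).Corhat),
        J = MulAut.conj r • ((M.toTemperedCurve.inertia x₀ ⊓ C.Huu).map M.inclX).map ιW := by
    intro J
    rw [← hJ₀']
    exact isCuspidalInertia_piV_iff_rangeX e C μ hC hS hl hp2 hpl hζ hη ι hι hinj Φ hΦ hΦK hZ hN T Cu hCuPM hlev hR231 J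
  rw [card_labCuspPM_level_eq_index
    (Qsub := (ofCoverModel e C μ hC hS hl hp2 hpl hζ hη ι hι hinj Φ hΦ hΦK hZ hN T).piV)
    (Qsup := (ofCoverModel e C μ hC hS hl hp2 hpl hζ hη ι hι hinj Φ hΦ hΦK hZ hN T).piPM)
    (R := (M.inclX.range.map ιW : Subgroup (ofCoverModel e C μ hC hS hl hp2 hpl hζ hη ι hι hinj Φ hΦ hΦK hZ hN T).Corhat))
    (J₀ := ((M.toTemperedCurve.inertia x₀ ⊓ C.Huu).map M.inclX).map ιW) ?_ hQR hRQ hhom]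
  · -- `N_{Π^±_v}(J₀ ∩ Π_v) = ι(inclX D_{x₀})`, whose normaliser in `ι(inclX Π^tp_X)` lies in `Π^±_v`
    have hN₀ : Subgroup.normalizer ((((M.toTemperedCurve.inertia x₀ ⊓ C.Huu).map M.inclX).map ιW :
          Subgroup (ofCoverModel e C μ hC hS hl hp2 hpl hζ hη ι hι hinj Φ hΦ hΦK hZ hN T).Corhat) : Set _) ⊓
            (ofCoverModel e C μ hC hS hl hp2 hpl hζ hη ι hι hinj Φ hΦ hΦK hZ hN T).piPM =
        ((M.decomp x₀).map M.inclX).map ιW := by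
      rw [hPM]
      exact normalizer_map_inertiaInfHuu_inf_piPM_eq C ι hinj hN op hx₀ h65ii
    rw [hN₀]
    have hsup : (Subgroup.normalizer ((((M.decomp x₀).map M.inclX).map ιW :
          Subgroup (ofCoverModel e C μ hC hS hl hp2 hpl hζ hη ι hι hinj Φ hΦ hΦK hZ hN T).Corhat) : Set _)).subgroupOf
            (M.inclX.range.map ιW) ≤
        (ofCoverModel e C μ hC hS hl hp2 hpl hζ hη ι hι hinj Φ hΦ hΦK hZ hN T).piPM.subgroupOf (M.inclX.range.map ιW) := by
      intro r hr
      rw [Subgroup.mem_subgroupOf] at hr ⊢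
      rw [hPM]
      exact normalizer_map_decomp_le_piPM ι hinj op hx₀ h65 r.2 (mem_normalizer_iff_conj_smul_eq.mp hr)
    rw [sup_eq_right.mpr hsup, hPM]
    exact index_map_GtpXu_subgroupOf_rangeX ι hinj
  · -- `J₀ ∩ Π_v ≤ Π^±_v`
    rw [hPM]
    exact Subgroup.map_mono (Subgroup.map_mono (inf_le_left.trans (inertia_le_GtpXu op hx₀)))

/-- **Def 2.3 (iii)'s INTERFACE `LabCuspStructure Cu` IS INHABITED at the genuine tower `ofCoverModel`** for every such datum: `|LabCusp^±(Π_v)| = l`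
gives a bijection with `𝔽_l`, whence (abc-iut-w5-d028's `LabCuspStructure.nonempty_iff_nonempty_equiv`) the `𝔽_l^×`-action, zero element and
`±`-canonical element.  (First conjunct of abc-iut-w5-d243's `def23_structuresConj_iff_card`.) ([IUTchII] Def 2.3 (iii), kurims p.68) [claim: Mochizuki2012, status: disputed] -/
theorem nonempty_labCuspStructure_ofCoverModel (op : M.toThetaSetting.OncePuncturedData) (hx₀ : M.IsCusp x₀)
    (h65 : M.toTemperedCurve.DecompCommensurablyTerminal) (h65ii : M.toTemperedCurve.DecompEqCommensuratorOfOpenInertia)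
    (Cu : CuspidalInertiaData (ofCoverModel e C μ hC hS hl hp2 hpl hζ hη ι hι hinj Φ hΦ hΦK hZ hN T))
    (hCuPM : ∀ I : Subgroup (ofCoverModel e C μ hC hS hl hp2 hpl hζ hη ι hι hinj Φ hΦ hΦK hZ hN T).Corhat,
      Cu.IsCuspidalInertia (ofCoverModel e C μ hC hS hl hp2 hpl hζ hη ι hι hinj Φ hΦ hΦK hZ hN T).piPM I ↔
        ∃ r ∈ (M.inclX.range.map ι.toMonoidHom : Subgroup (ofCoverModel e C μ hC hS hl hp2 hpl hζ hη ι hι hinj Φ hΦ hΦK hZ hN T).Corhat),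
          I = MulAut.conj r • (((M.toTemperedCurve.inertia x₀).map M.inclX).map ι.toMonoidHom :
            Subgroup (ofCoverModel e C μ hC hS hl hp2 hpl hζ hη ι hι hinj Φ hΦ hΦK hZ hN T).Corhat))
    (hlev : ∀ J : Subgroup (ofCoverModel e C μ hC hS hl hp2 hpl hζ hη ι hι hinj Φ hΦ hΦK hZ hN T).Corhat,
      Cu.IsCuspidalInertia (ofCoverModel e C μ hC hS hl hp2 hpl hζ hη ι hι hinj Φ hΦ hΦK hZ hN T).piV J ↔
        J ≤ (ofCoverModel e C μ hC hS hl hp2 hpl hζ hη ι hι hinj Φ hΦ hΦK hZ hN T).piV ∧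
          ∃ I₀, Cu.IsCuspidalInertia (ofCoverModel e C μ hC hS hl hp2 hpl hζ hη ι hι hinj Φ hΦ hΦK hZ hN T).piPM I₀ ∧
            J = I₀ ⊓ (ofCoverModel e C μ hC hS hl hp2 hpl hζ hη ι hι hinj Φ hΦ hΦK hZ hN T).piV)
    (hR231 : Rmk231_powers Cu (ofCoverModel e C μ hC hS hl hp2 hpl hζ hη ι hι hinj Φ hΦ hΦK hZ hN T).piV
      (ofCoverModel e C μ hC hS hl hp2 hpl hζ hη ι hι hinj Φ hΦ hΦK hZ hN T).piPM) :
    Nonempty (LabCuspStructure Cu) := by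
  rw [LabCuspStructure.nonempty_iff_nonempty_equiv]
  have hcard := card_labCuspPM_piV_ofCoverModel_eq_l e C μ hC hS hl hp2 hpl hζ hη ι hι hinj Φ hΦ hΦK hZ hN T op hx₀ h65 h65ii Cu hCuPM
    hlev hR231
  haveI : Finite (LabCuspPM Cu (ofCoverModel e C μ hC hS hl hp2 hpl hζ hη ι hι hinj Φ hΦ hΦK hZ hN T).piV
      (ofCoverModel e C μ hC hS hl hp2 hpl hζ hη ι hι hinj Φ hΦ hΦK hZ hN T).piPM) :=
    Nat.finite_of_card_ne_zero (by rw [hcard]; exact hl.ne_zero)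
  haveI : NeZero (BadPlaceSetting.ofUnderline C μ hC hS hl hp2 hpl hζ hη).l := ⟨hl.ne_zero⟩
  exact Finite.card_eq.mp (by rw [hcard, Nat.card_zmod]; rfl)

end Tower

end PlusMinusTower

end Literature.IUT.HodgeArakelov

end
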